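import Summits.BirchSwinnertonDyer.Rank1Residual.AdditivePotMult.ShaIsotropicCasselsTate
import Summits.BirchSwinnertonDyer.Rank1Residual.AdditivePotMult.RankZeroShaCertificate
import Summits.BirchSwinnertonDyer.Rank1Residual.SecondDescent.BSDpFromSecondDescentNonempty
import Summits.BirchSwinnertonDyer.Rank1Residual.AdditivePotMult.RankZeroThreeTwistFacts
import HarnessLib

/-!
# X4(M), rank `0`, the `ord_p #Ш_an = 4` rows: `BSD(E,p)` from the published UPPER half and ONE finite
# certificate for `p⁴ ∣ #Ш(E/ℚ)` — an ISOTROPIC Cassels–Tate Gram matrix on `Ш[p] = Sel^(p)`, or two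
# second-descent `NONEMPTY` witnesses, or a level-`p²` descent count (cell `b2b-bsdres`, sub-cell
# additive-p1, gen 17)

HONEST FRAMING (cell `b2b-bsdres`, run/shared/lean/b2b/bsd-rank1-residual/, verbatim in every
file): the goal of the cell is to DELETE the COMBINATION-SHAPED residual classes of the
Birch–Swinnerton-Dyer formula for ALL analytic-rank `≤ 1` elliptic curves over `ℚ` — "full BSD
formula for every rank `≤ 1` curve in class `C`" assembled STRICTLY from published theorems — so
that the rank-`≤ 1` remainder becomes exactly the CONSTRUCTION-SHAPED classes, which are TYPED
(missing-input `Prop`s), NOT attempted. This is not "finishing BSD". Sub-cell additive-p1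
(X3♯(M) / X4(M): additive, potentially MULTIPLICATIVE prime) is a research route; X3♯(M) and X4(M)
stay CONSTRUCTION-SHAPED; nothing is booked by this file (the lane books, the referee signs); the
census rows named below are EVIDENCE pointers, never inputs. THEOREMS ONLY (no definition, no named
fact, no `sorry`).

## What this file does

The (M) residue map of gen 16 (`HOME/b2b-bsdres-additive-p1/census-g16/M-RESIDUE-book210.md`) has
ONE block with no kernel road: the 34 (+1 at `p = 5`) X4(M) ∧ surj ∧ `r_an = 0` cells with
`ord_p #Ш(E)_an = 4` (x11c: `dim_{𝔽₃} Sel^(3)(E/ℚ) = 2` EXACT on all 34, i.e. `Ш(E)[3] = (ℤ/3)²`,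
consistent with the predicted `Ш(E)[3^∞] = (ℤ/9)²`). The published UPPER half
`ord_p #Ш(E) ≤ ord_p #Ш(E)_an` is the gen-9 class theorem
(`ClassX4M.bsdp_rankZero_of_surj_of_lower`: Delbourgo 1998 Prop. 4, GZK, modularity, Wuthrich 2014
Lemma 20, Kato's divisibility on the `ω^{(p−1)/2}`-component); the LOWER half needs `p³ ∣ #Ш(E)`
(Cassels–Tate squareness then gives `p⁴`), which a plain `p`-descent CANNOT see when
`Ш[p^∞] = (ℤ/p²)²`. This file supplies the kernel road for three existing instruments:

* The kernel half of that sentence is the sibling TOOL file `ShaIsotropicCasselsTate.lean` (this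
  sub-cell, gen 17): for a finite abelian group with an alternating non-degenerate pairing
  ISOTROPIC on `A[p]`, `A[p] ⊆ pA` and `(#A[p])² ∣ #A`; on `Ш(E/ℚ)` at rank `0` with
  `p ∤ #E(ℚ)_tors`, `#Sel^(p) = p^d` and a pairing with the PRINTED Cassels–Tate properties
  (Silverman X.4.14) vanishing on `Ш[p]` give `p^{2d} ∣ #Ш` and, when `ord_p #Ш_an ≤ 2d`, the typed
  LOWER half `MissingLowerBoundAt W p` (`missingLowerBoundAt_of_casselsTateIsotropic_of_card_selmerGroup`)
  — NO parity step.
* THIS FILE (X4(M) consumers, every odd `p` and the `p = 3` readings of record A123). `BSD(E,p)` on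
  X4(M) ∧ surj(p) ∧ `r_an = 0`, `ord_p #Ш_an ≤ 2d`, from (a) `#Sel^(p) = p^d` + an isotropic
  Cassels–Tate pairing on `Ш[p]` (instrument: the cell's CTP-on-`Sel^(3)` route A `ctp-sel3` of unit
  x10 + verifier route B `ctpB` of engines/eng-exactrec — a ZERO-type document); (b) two
  second-`p`-descent `NONEMPTY` witnesses (instrument B-1 `SEL3CT-ALT`, class-closure cc-eng-4;
  kernel `SecondDescent.missingLowerBoundAt_of_casselsTate_of_two_divisible'`); (c) the level-`p²`
  count `p^{2d−1} ∣ #Sel^(p²)(E/ℚ)` (kernel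
  `Supersingular.missingLowerBoundAt_of_casselsTate_of_dvd_card_selmerGroup_pow`). Surjectivity is
  decided in the kernel by `p ∤ ord_p j(E)` where wanted (`ClassX4M.surj_of_not_dvd_padicValRat_j`).

Inputs beyond the pair (all published, all already binders of the gen-9/gen-11 levers): Delbourgo
1998 Prop. 4 (`hDel`), Gross–Zagier–Kolyvagin (`hGZK`), modularity (`hmod`, `hmodD`), Wuthrich 2014
Lemma 20 (`hL20`), the Kato component reading (`hKato` = A136 at odd `p` / A123 at `p = 3`), and —
for routes (b), (c) only — Cassels–Tate (`hCT`). Route (a) does not take `hCT`: the certificate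
binder itself carries a pairing with the printed Cassels–Tate properties. Per pair; NOT a class
theorem; labels unchanged (X4(M) CONSTRUCTION-SHAPED; N10 (M) NEEDS X_E1).

EVIDENCE pointers (lane data; nothing run or booked here): the 34 cells at `p = 3` and 1 at `p = 5`
of `census-g16/M-RESIDUE-book210.tsv` with `vp_sha_an = 4` (list filed with the hand-over note
`census-g17/SHA81-M-ROWS.tsv`).

References: Cassels 1962 [Cassels1962ArithmeticIV]; Silverman *AEC* X.4.14, X.4.2
[SilvermanAEC2009]; Cassels 1998 §1 [Cassels1998]; Fisher–Newton 2014 Thm. 1.3 [FisherNewton2014];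
Creutz 2014 §1 [Creutz2014]; Delbourgo 1998 Prop. 4 [Delbourgo1998]; Wuthrich 2014 Lemma 20, Cor. 19
[Wuthrich2014]; Kato 2004 Thm. 17.4 [Kato2004Asterisque]; Miller 2011 Def. 1.1 [Miller2011LMS].
-/

noncomputable section

open scoped Classical

open WeierstrassCurve Literature.NumberTheory.EllipticCurves
  Literature.NumberTheory.EllipticCurves.ModularForms
  Literature.NumberTheory.EllipticCurves.Rank1Residual
  Literature.NumberTheory.EllipticCurves.Rank1Residual.Typed
  Literature.GroupTheory.FiniteAbelian

namespace Summit.BirchSwinnertonDyer.Rank1Residual.AdditivePotMult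

/-! ### X4(M) ∧ surj(p) ∧ `r_an = 0`: `BSD(E,p)` from the published upper half and ONE certificate -/

section ClassX4M

open Additive GaloisImage

variable {W : WeierstrassCurve ℚ} [W.IsElliptic] [W.IsGloballyMinimal] {p : ℕ} [hp : Fact p.Prime]

/-- **Route (a), every odd `p`: X4(M) ∧ surj(p) ∧ `r_an(E) = 0`, `#Sel^(p)(E/ℚ) = p^d`, the
Cassels–Tate pairing ISOTROPIC on `Ш[p]`, `ord_p #Ш_an(E) ≤ 2d` ⇒ `BSD(E,p)`.** Upper half: the gen-9
class theorem `ClassX4M.bsdp_rankZero_of_surj_of_lower` (Delbourgo 1998 Prop. 4 `hDel`, GZK,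
modularity, Wuthrich Lemma 20 `hL20`, Kato's `ω^{(p−1)/2}`-component reading `hKato` = A136); lower
half: the sibling's `missingLowerBoundAt_of_casselsTateIsotropic_of_card_selmerGroup` (no parity step, no `hCT`). `p ∤ #E(ℚ)_tors` from the irreducibility inside `ClassX4`. Per
pair; NOT a class theorem. [cite: Delbourgo1998, Prop. 4 (p. 144)] [cite: Wuthrich2014, Lemma 20 (p. 399), Cor. 19 (p. 398)]
[cite: Kato2004Asterisque, Thm. 17.4 (3) (p. 273)] [cite: SilvermanAEC2009, Thm. X.4.14 and Thm. X.4.2(a)]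
[cite: Miller2011LMS, §1 and Def. 1.1] -/
theorem ClassX4M.bsdp_rankZero_of_surj_of_casselsTateIsotropic_of_card_selmerGroup
    (hDel : Delbourgo1998.prop4_rankZero_pow_dvd_constantCoeff)
    (hGZK : rank_eq_analyticRank_of_analyticRank_le_one) (hmod : hasEntireLFunction_rat)
    (hmodD : nonempty_modularParametrizationData)
    (hL20 : Wuthrich2014.lemma20_surjective_threeAdic_of_semistable)
    (hKato : Wuthrich2014.kato_halfEigenCharIdeal_dvd_cyclotomicPrime_of_surjective)
    (hX : ClassX4M W p) (hr : W.analyticRank = 0) (hsurj : Surj W p)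
    {d : ℕ} (hSel : Nat.card (W.selmerGroup (p : ℤ)) = p ^ d)
    (hCT0 : ∃ B : W.sha →+ W.sha →+ AddCircle (1 : ℚ), (∀ x, B x x = 0) ∧
      (∀ x, (∀ y, B x y = 0) ↔ x ∈ AddSubgroup.divisibleElements W.sha) ∧
      ∀ x y : W.sha, p • x = 0 → p • y = 0 → B x y = 0)
    {q : ℚ} (hq : shaAn W = (q : ℂ)) (hv : padicValRat p q ≤ 2 * d) : BSDp W p :=
  ClassX4M.bsdp_rankZero_of_surj_of_lower hDel hGZK hmod hmodD hL20 hKato hX hr hsurj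
    (missingLowerBoundAt_of_casselsTateIsotropic_of_card_selmerGroup W p hGZK hr
      (Supersingular.not_dvd_torsionOrder_of_irr W p hX.irr) hSel hCT0 hq hv)

/-- Route (a) with surj(p) decided in the kernel by `p ∤ ord_p j(E)`
(`ClassX4M.surj_of_not_dvd_padicValRat_j`). [cite: SilvermanATAEC1994, V.6 Prop. 6.1 (p. 410) and V.5.3]
[cite: SilvermanAEC2009, Thm. X.4.14] [cite: Wuthrich2014, Lemma 20 (p. 399), Cor. 19 (p. 398)] -/
theorem ClassX4M.bsdp_rankZero_of_not_dvd_padicValRat_j_of_casselsTateIsotropic_of_card_selmerGroup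
    (hDel : Delbourgo1998.prop4_rankZero_pow_dvd_constantCoeff)
    (hGZK : rank_eq_analyticRank_of_analyticRank_le_one) (hmod : hasEntireLFunction_rat)
    (hmodD : nonempty_modularParametrizationData)
    (hL20 : Wuthrich2014.lemma20_surjective_threeAdic_of_semistable)
    (hKato : Wuthrich2014.kato_halfEigenCharIdeal_dvd_cyclotomicPrime_of_surjective)
    (hX : ClassX4M W p) (hr : W.analyticRank = 0) (hj : ¬ (p : ℤ) ∣ padicValRat p W.j)
    {d : ℕ} (hSel : Nat.card (W.selmerGroup (p : ℤ)) = p ^ d)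
    (hCT0 : ∃ B : W.sha →+ W.sha →+ AddCircle (1 : ℚ), (∀ x, B x x = 0) ∧
      (∀ x, (∀ y, B x y = 0) ↔ x ∈ AddSubgroup.divisibleElements W.sha) ∧
      ∀ x y : W.sha, p • x = 0 → p • y = 0 → B x y = 0)
    {q : ℚ} (hq : shaAn W = (q : ℂ)) (hv : padicValRat p q ≤ 2 * d) : BSDp W p :=
  ClassX4M.bsdp_rankZero_of_surj_of_casselsTateIsotropic_of_card_selmerGroup hDel hGZK hmod hmodD
    hL20 hKato hX hr (ClassX4M.surj_of_not_dvd_padicValRat_j hX hj) hSel hCT0 hq hv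

/-- **Route (a), every odd `p`: the typed missing input `X4.MissingInputAt W p` HOLDS** at an
X4(M) ∧ surj(p) ∧ `r_an = 0` pair from the published upper half (A136) and the isotropic certificate
(`ClassX4M.missingInputAt_iff_lower_rankZero_of_surj`). Bookkeeping; per pair.
[cite: Miller2011LMS, Def. 1.1] [cite: SilvermanAEC2009, Thm. X.4.14] -/
theorem ClassX4M.missingInputAt_of_surj_of_casselsTateIsotropic_of_card_selmerGroup_rankZero
    (hDel : Delbourgo1998.prop4_rankZero_pow_dvd_constantCoeff)
    (hGZK : rank_eq_analyticRank_of_analyticRank_le_one) (hmod : hasEntireLFunction_rat)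
    (hmodD : nonempty_modularParametrizationData)
    (hL20 : Wuthrich2014.lemma20_surjective_threeAdic_of_semistable)
    (hKato : Wuthrich2014.kato_halfEigenCharIdeal_dvd_cyclotomicPrime_of_surjective)
    (hX : ClassX4M W p) (hr : W.analyticRank = 0) (hsurj : Surj W p)
    {d : ℕ} (hSel : Nat.card (W.selmerGroup (p : ℤ)) = p ^ d)
    (hCT0 : ∃ B : W.sha →+ W.sha →+ AddCircle (1 : ℚ), (∀ x, B x x = 0) ∧
      (∀ x, (∀ y, B x y = 0) ↔ x ∈ AddSubgroup.divisibleElements W.sha) ∧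
      ∀ x y : W.sha, p • x = 0 → p • y = 0 → B x y = 0)
    {q : ℚ} (hq : shaAn W = (q : ℂ)) (hv : padicValRat p q ≤ 2 * d) : X4.MissingInputAt W p :=
  (ClassX4M.missingInputAt_iff_lower_rankZero_of_surj hDel hGZK hmod hmodD hL20 hKato hX hr hsurj).mpr
    (missingLowerBoundAt_of_casselsTateIsotropic_of_card_selmerGroup W p hGZK hr
      (Supersingular.not_dvd_torsionOrder_of_irr W p hX.irr) hSel hCT0 hq hv)

/-- **Route (a) at `p = 3` (the reading of record A123 for the 34 rows): X4(M) ∧ surj(3) ∧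
`r_an(E) = 0`, `#Sel^(3)(E/ℚ) = 3^d`, the Cassels–Tate pairing ISOTROPIC on `Ш[3]`,
`ord₃ #Ш_an(E) ≤ 2d` ⇒ `BSD(E,3)`.** Upper half: `ClassX4M.bsdp_three_rankZero_of_surj_of_lower`
(Delbourgo Prop. 4, GZK, modularity, Wuthrich Lemma 20, Kato 17.4 (3)–Cor. 19 `ω`-component `hKato`
= A123). Booking shape for the 34 cells: `d = 2` (`#Sel^(3) = 9`, x11c EXACT), `ord₃ #Ш_an = 4`,
ONE ZERO-type CTP document each. Per pair; NOT a class theorem. [cite: Delbourgo1998, Prop. 4 (p. 144)]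
[cite: Wuthrich2014, Lemma 20 (p. 399), Cor. 19 (p. 398)] [cite: Kato2004Asterisque, Thm. 17.4 (3) (p. 273)]
[cite: SilvermanAEC2009, Thm. X.4.14 and Thm. X.4.2(a)] [cite: Miller2011LMS, §1 and Def. 1.1] -/
theorem ClassX4M.bsdp_three_rankZero_of_surj_of_casselsTateIsotropic_of_card_selmerThree
    (hDel : Delbourgo1998.prop4_rankZero_pow_dvd_constantCoeff)
    (hGZK : rank_eq_analyticRank_of_analyticRank_le_one) (hmod : hasEntireLFunction_rat)
    (hmodD : nonempty_modularParametrizationData)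
    (hL20 : Wuthrich2014.lemma20_surjective_threeAdic_of_semistable)
    (hKato : Wuthrich2014.kato_minusEigenCharIdeal_dvd_cyclotomicThree_of_surjective)
    (hX : ClassX4M W 3) (hr : W.analyticRank = 0) (hsurj : Surj W 3)
    {d : ℕ} (hSel : Nat.card (W.selmerGroup (3 : ℤ)) = 3 ^ d)
    (hCT0 : ∃ B : W.sha →+ W.sha →+ AddCircle (1 : ℚ), (∀ x, B x x = 0) ∧
      (∀ x, (∀ y, B x y = 0) ↔ x ∈ AddSubgroup.divisibleElements W.sha) ∧
      ∀ x y : W.sha, 3 • x = 0 → 3 • y = 0 → B x y = 0)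
    {q : ℚ} (hq : shaAn W = (q : ℂ)) (hv : padicValRat 3 q ≤ 2 * d) : BSDp W 3 :=
  haveI : Fact (Nat.Prime 3) := ⟨Nat.prime_three⟩
  ClassX4M.bsdp_three_rankZero_of_surj_of_lower hDel hGZK hmod hmodD hL20 hKato hX hr hsurj
    (missingLowerBoundAt_of_casselsTateIsotropic_of_card_selmerGroup W 3 hGZK hr
      (Supersingular.not_dvd_torsionOrder_of_irr W 3 hX.irr) (by exact_mod_cast hSel)
      (by exact_mod_cast hCT0) hq hv)

/-- **The 34-row shape verbatim**: X4(M) ∧ surj(3) ∧ `r_an = 0`, `#Sel^(3)(E/ℚ) = 9`, ZERO Cassels–Tate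
pairing on `Ш[3]`, `ord₃ #Ш_an = 4` ⇒ `BSD(E,3)`. [cite: Delbourgo1998, Prop. 4 (p. 144)]
[cite: Wuthrich2014, Lemma 20 (p. 399), Cor. 19 (p. 398)] [cite: SilvermanAEC2009, Thm. X.4.14 and Thm. X.4.2(a)] -/
theorem ClassX4M.bsdp_three_rankZero_of_surj_of_casselsTateIsotropic_of_card_selmerThree_eq_nine
    (hDel : Delbourgo1998.prop4_rankZero_pow_dvd_constantCoeff)
    (hGZK : rank_eq_analyticRank_of_analyticRank_le_one) (hmod : hasEntireLFunction_rat)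
    (hmodD : nonempty_modularParametrizationData)
    (hL20 : Wuthrich2014.lemma20_surjective_threeAdic_of_semistable)
    (hKato : Wuthrich2014.kato_minusEigenCharIdeal_dvd_cyclotomicThree_of_surjective)
    (hX : ClassX4M W 3) (hr : W.analyticRank = 0) (hsurj : Surj W 3)
    (hSel : Nat.card (W.selmerGroup (3 : ℤ)) = 9)
    (hCT0 : ∃ B : W.sha →+ W.sha →+ AddCircle (1 : ℚ), (∀ x, B x x = 0) ∧
      (∀ x, (∀ y, B x y = 0) ↔ x ∈ AddSubgroup.divisibleElements W.sha) ∧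
      ∀ x y : W.sha, 3 • x = 0 → 3 • y = 0 → B x y = 0)
    {q : ℚ} (hq : shaAn W = (q : ℂ)) (hv : padicValRat 3 q = 4) : BSDp W 3 :=
  ClassX4M.bsdp_three_rankZero_of_surj_of_casselsTateIsotropic_of_card_selmerThree hDel hGZK hmod
    hmodD hL20 hKato hX hr hsurj (d := 2) (by rw [hSel]; norm_num) hCT0 hq (by rw [hv]; norm_num)

/-- Route (a) at `p = 3` with surj(3) decided by `3 ∤ ord₃ j(E)` (`ClassX4M.surj_of_not_dvd_padicValRat_j`;
x11c's 34 rows carry `ord₃ j`). [cite: SilvermanATAEC1994, V.6 Prop. 6.1 (p. 410) and V.5.3]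
[cite: SilvermanAEC2009, Thm. X.4.14] [cite: Wuthrich2014, Lemma 20 (p. 399), Cor. 19 (p. 398)] -/
theorem ClassX4M.bsdp_three_rankZero_of_not_dvd_padicValRat_j_of_casselsTateIsotropic
    (hDel : Delbourgo1998.prop4_rankZero_pow_dvd_constantCoeff)
    (hGZK : rank_eq_analyticRank_of_analyticRank_le_one) (hmod : hasEntireLFunction_rat)
    (hmodD : nonempty_modularParametrizationData)
    (hL20 : Wuthrich2014.lemma20_surjective_threeAdic_of_semistable)
    (hKato : Wuthrich2014.kato_minusEigenCharIdeal_dvd_cyclotomicThree_of_surjective)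
    (hX : ClassX4M W 3) (hr : W.analyticRank = 0) (hj : ¬ (3 : ℤ) ∣ padicValRat 3 W.j)
    {d : ℕ} (hSel : Nat.card (W.selmerGroup (3 : ℤ)) = 3 ^ d)
    (hCT0 : ∃ B : W.sha →+ W.sha →+ AddCircle (1 : ℚ), (∀ x, B x x = 0) ∧
      (∀ x, (∀ y, B x y = 0) ↔ x ∈ AddSubgroup.divisibleElements W.sha) ∧
      ∀ x y : W.sha, 3 • x = 0 → 3 • y = 0 → B x y = 0)
    {q : ℚ} (hq : shaAn W = (q : ℂ)) (hv : padicValRat 3 q ≤ 2 * d) : BSDp W 3 :=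
  haveI : Fact (Nat.Prime 3) := ⟨Nat.prime_three⟩
  ClassX4M.bsdp_three_rankZero_of_surj_of_casselsTateIsotropic_of_card_selmerThree hDel hGZK hmod
    hmodD hL20 hKato hX hr (ClassX4M.surj_of_not_dvd_padicValRat_j hX hj) hSel hCT0 hq hv

/-- **Route (b) at `p = 3`: TWO second-`3`-descent `NONEMPTY` witnesses** (classes `c₁ ≠ 0`,
`c₂ ∉ ℤ∙c₁` of `Ш[3]`, each a third multiple `cᵢ = 3 • dᵢ`; instrument B-1 `SEL3CT-ALT` of the
class-closure lane) on X4(M) ∧ surj(3) ∧ `r_an = 0` with `ord₃ #Ш_an ≤ 4` ⇒ `BSD(E,3)` — the X4(M)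
twin of cc-eng-4's X6/X7/X8 consumers (`SecondDescent.missingLowerBoundAt_of_casselsTate_of_two_divisible'`,
Cassels–Tate parity `hCT` turns `3⁴ ∣ #Ш` ⊇ `3³ ∣ #Ш` into the lower half). Per pair.
[cite: Creutz2014, §1] [cite: SilvermanAEC2009, Thm. X.4.14] [cite: Delbourgo1998, Prop. 4 (p. 144)]
[cite: Wuthrich2014, Lemma 20 (p. 399), Cor. 19 (p. 398)] -/
theorem ClassX4M.bsdp_three_rankZero_of_surj_of_two_nonempty
    (hCT : exists_casselsTate_pairing (K := ℚ))
    (hDel : Delbourgo1998.prop4_rankZero_pow_dvd_constantCoeff)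
    (hGZK : rank_eq_analyticRank_of_analyticRank_le_one) (hmod : hasEntireLFunction_rat)
    (hmodD : nonempty_modularParametrizationData)
    (hL20 : Wuthrich2014.lemma20_surjective_threeAdic_of_semistable)
    (hKato : Wuthrich2014.kato_minusEigenCharIdeal_dvd_cyclotomicThree_of_surjective)
    (hX : ClassX4M W 3) (hr : W.analyticRank = 0) (hsurj : Surj W 3)
    {c₁ c₂ d₁ d₂ : W.sha} (h1 : 3 • c₁ = 0) (h2 : 3 • c₂ = 0) (hc₁ : c₁ ≠ 0)
    (hind : c₂ ∉ AddSubgroup.zmultiples c₁) (hd₁ : 3 • d₁ = c₁) (hd₂ : 3 • d₂ = c₂)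
    {q : ℚ} (hq : shaAn W = (q : ℂ)) (hv : padicValRat 3 q ≤ 4) : BSDp W 3 :=
  haveI : Fact (Nat.Prime 3) := ⟨Nat.prime_three⟩
  ClassX4M.bsdp_three_rankZero_of_surj_of_lower hDel hGZK hmod hmodD hL20 hKato hX hr hsurj
    (SecondDescent.missingLowerBoundAt_of_casselsTate_of_two_divisible' W 3 hCT hGZK (by omega)
      h1 h2 hc₁ hind hd₁ hd₂ hq hv)

/-- **Route (c) at `p = 3`: the level-`9` descent count** `3^{2k−1} ∣ #Sel^(9)(E/ℚ)` (rank `0`,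
`3 ∤ #E(ℚ)_tors` from irreducibility) on X4(M) ∧ surj(3) ∧ `r_an = 0` with `ord₃ #Ш_an ≤ 2k` ⇒
`BSD(E,3)` — the X4(M) twin of additive-p3's X6/X7/X8 consumers
(`Supersingular.missingLowerBoundAt_of_casselsTate_of_dvd_card_selmerGroup_pow`, `j = 2`). For the 34
rows: `k = 2`, `27 ∣ #Sel^(9)` (predicted `#Sel^(9) = 81`). Per pair.
[cite: SilvermanAEC2009, Thm. X.4.2(a) and Thm. X.4.14] [cite: Delbourgo1998, Prop. 4 (p. 144)]
[cite: Wuthrich2014, Lemma 20 (p. 399), Cor. 19 (p. 398)] -/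
theorem ClassX4M.bsdp_three_rankZero_of_surj_of_casselsTate_of_dvd_card_selmerNine
    (hCT : exists_casselsTate_pairing (K := ℚ))
    (hDel : Delbourgo1998.prop4_rankZero_pow_dvd_constantCoeff)
    (hGZK : rank_eq_analyticRank_of_analyticRank_le_one) (hmod : hasEntireLFunction_rat)
    (hmodD : nonempty_modularParametrizationData)
    (hL20 : Wuthrich2014.lemma20_surjective_threeAdic_of_semistable)
    (hKato : Wuthrich2014.kato_minusEigenCharIdeal_dvd_cyclotomicThree_of_surjective)
    (hX : ClassX4M W 3) (hr : W.analyticRank = 0) (hsurj : Surj W 3)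
    {q : ℚ} (hq : shaAn W = (q : ℂ)) {k : ℕ} (hv : padicValRat 3 q ≤ 2 * k)
    (hcard : 3 ^ (2 * k - 1) ∣ Nat.card (W.selmerGroup ((3 ^ 2 : ℕ) : ℤ))) : BSDp W 3 :=
  haveI : Fact (Nat.Prime 3) := ⟨Nat.prime_three⟩
  ClassX4M.bsdp_three_rankZero_of_surj_of_lower hDel hGZK hmod hmodD hL20 hKato hX hr hsurj
    (Supersingular.missingLowerBoundAt_of_casselsTate_of_dvd_card_selmerGroup_pow W 3 hCT hGZK
      (by omega) 2 (Supersingular.not_dvd_torsionOrder_of_irr W 3 hX.irr) hq hv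
      (by rw [hr, mul_zero, zero_add]; exact hcard))

/-- **Discharging the typed missing input of X4 at such a pair** (route (a), `p = 3`): the typed
`X4.MissingInputAt W 3` HOLDS from the published upper half and the isotropic certificate.
Bookkeeping; per pair. [cite: Miller2011LMS, Def. 1.1] [cite: SilvermanAEC2009, Thm. X.4.14] -/
theorem ClassX4M.missingInputAt_three_of_surj_of_casselsTateIsotropic_of_card_selmerThree
    (hDel : Delbourgo1998.prop4_rankZero_pow_dvd_constantCoeff)
    (hGZK : rank_eq_analyticRank_of_analyticRank_le_one) (hmod : hasEntireLFunction_rat)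
    (hmodD : nonempty_modularParametrizationData)
    (hL20 : Wuthrich2014.lemma20_surjective_threeAdic_of_semistable)
    (hKato : Wuthrich2014.kato_minusEigenCharIdeal_dvd_cyclotomicThree_of_surjective)
    (hX : ClassX4M W 3) (hr : W.analyticRank = 0) (hsurj : Surj W 3)
    {d : ℕ} (hSel : Nat.card (W.selmerGroup (3 : ℤ)) = 3 ^ d)
    (hCT0 : ∃ B : W.sha →+ W.sha →+ AddCircle (1 : ℚ), (∀ x, B x x = 0) ∧
      (∀ x, (∀ y, B x y = 0) ↔ x ∈ AddSubgroup.divisibleElements W.sha) ∧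
      ∀ x y : W.sha, 3 • x = 0 → 3 • y = 0 → B x y = 0)
    {q : ℚ} (hq : shaAn W = (q : ℂ)) (hv : padicValRat 3 q ≤ 2 * d) : X4.MissingInputAt W 3 :=
  haveI : Fact (Nat.Prime 3) := ⟨Nat.prime_three⟩
  (ClassX4M.missingInputAt_iff_lower_three_rankZero_of_surj hDel hGZK hmod hmodD hL20 hKato hX hr
      hsurj).mpr
    (missingLowerBoundAt_of_casselsTateIsotropic_of_card_selmerGroup W 3 hGZK hr
      (Supersingular.not_dvd_torsionOrder_of_irr W 3 hX.irr) (by exact_mod_cast hSel)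
      (by exact_mod_cast hCT0) hq hv)

/-! ### Appendix (gen 17): the X4♯(G-ord) twin at `p = 3` — the 5 G-ord rows of n1011's NICHE39

The `ord₃ #Ш_an = 4` niche of the n1011 team (`cells/n1011/route2/g28/NICHE39-END-per-row-g28.tsv`)
has, besides the 34 (M) rows above, five X4♯(G-ord) rows with Kodaira type `I₀*` at `3` (tame,
`e = semistabilityIndex = 2`): `19215t1, 92466r1, 240120f1, 437742q1, 499023j1`. Their published
upper half is this sub-cell's gen-9 twin `ClassX4Gord.missingUpperBoundAt_three_rankZero_of_surj`
(`RankZeroThreeTwistFacts.lean`: Delbourgo Prop. 4, GZK, modularity, Wuthrich Lemma 20 on the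
good-ordinary twist `E^{(−3)}`, Kato 17.4 (3) `ω`-component `hKato` = A123); the lower half is the
same isotropic certificate. EVIDENCE pointers only; additive-p2's class; nothing booked. -/

/-- **Route (a) at `p = 3`, X4♯(G-ord) ∧ `e = 2` ∧ surj(3) ∧ `r_an(E) = 0`: `#Sel^(3)(E/ℚ) = 3^d`, the
Cassels–Tate pairing ISOTROPIC on `Ш[3]`, `ord₃ #Ш_an(E) ≤ 2d` ⇒ `BSD(E,3)`** — upper half
`ClassX4Gord.missingUpperBoundAt_three_rankZero_of_surj` (gen 9), lower half
`missingLowerBoundAt_of_casselsTateIsotropic_of_card_selmerGroup` (sibling TOOL file), glued by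
`missingPPartAt_of_lower_of_upper` / `bsdp_of_missingPPartAt`. Per pair; NOT a class theorem.
[cite: Delbourgo1998, Prop. 4 (p. 144)] [cite: Wuthrich2014, Lemma 20 (p. 399), Cor. 19 (p. 398)]
[cite: Kato2004Asterisque, Thm. 17.4 (3) (p. 273)] [cite: SilvermanAEC2009, Thm. X.4.14 and Thm. X.4.2(a)]
[cite: Miller2011LMS, §1 and Def. 1.1] -/
theorem ClassX4Gord.bsdp_three_rankZero_of_surj_of_casselsTateIsotropic_of_card_selmerThree
    (hDel : Delbourgo1998.prop4_rankZero_pow_dvd_constantCoeff)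
    (hGZK : rank_eq_analyticRank_of_analyticRank_le_one) (hmod : hasEntireLFunction_rat)
    (hmodD : nonempty_modularParametrizationData)
    (hL20 : Wuthrich2014.lemma20_surjective_threeAdic_of_semistable)
    (hKato : Wuthrich2014.kato_minusEigenCharIdeal_dvd_cyclotomicThree_of_surjective)
    (hX : ClassX4Gord W 3) (he : semistabilityIndex W 3 = 2) (hr : W.analyticRank = 0)
    (hsurj : Surj W 3) {d : ℕ} (hSel : Nat.card (W.selmerGroup (3 : ℤ)) = 3 ^ d)
    (hCT0 : ∃ B : W.sha →+ W.sha →+ AddCircle (1 : ℚ), (∀ x, B x x = 0) ∧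
      (∀ x, (∀ y, B x y = 0) ↔ x ∈ AddSubgroup.divisibleElements W.sha) ∧
      ∀ x y : W.sha, 3 • x = 0 → 3 • y = 0 → B x y = 0)
    {q : ℚ} (hq : shaAn W = (q : ℂ)) (hv : padicValRat 3 q ≤ 2 * d) : BSDp W 3 :=
  haveI : Fact (Nat.Prime 3) := ⟨Nat.prime_three⟩
  bsdp_of_missingPPartAt W 3 hGZK (by rw [hr]; norm_num)
    (missingPPartAt_of_lower_of_upper W 3
      (missingLowerBoundAt_of_casselsTateIsotropic_of_card_selmerGroup W 3 hGZK hr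
        (Supersingular.not_dvd_torsionOrder_of_irr W 3 hX.classX4.2.2) (by exact_mod_cast hSel)
        (by exact_mod_cast hCT0) hq hv)
      (ClassX4Gord.missingUpperBoundAt_three_rankZero_of_surj hDel hGZK hmod hmodD hL20 hKato hX he
        hr hsurj))

/-- The NICHE39 G-ord shape verbatim: `#Sel^(3)(E/ℚ) = 9`, ZERO Cassels–Tate pairing on `Ш[3]`,
`ord₃ #Ш_an = 4` ⇒ `BSD(E,3)` on X4♯(G-ord) ∧ `e = 2` ∧ surj(3) ∧ `r_an = 0`.
[cite: Delbourgo1998, Prop. 4 (p. 144)] [cite: SilvermanAEC2009, Thm. X.4.14 and Thm. X.4.2(a)] -/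
theorem ClassX4Gord.bsdp_three_rankZero_of_surj_of_casselsTateIsotropic_of_card_selmerThree_eq_nine
    (hDel : Delbourgo1998.prop4_rankZero_pow_dvd_constantCoeff)
    (hGZK : rank_eq_analyticRank_of_analyticRank_le_one) (hmod : hasEntireLFunction_rat)
    (hmodD : nonempty_modularParametrizationData)
    (hL20 : Wuthrich2014.lemma20_surjective_threeAdic_of_semistable)
    (hKato : Wuthrich2014.kato_minusEigenCharIdeal_dvd_cyclotomicThree_of_surjective)
    (hX : ClassX4Gord W 3) (he : semistabilityIndex W 3 = 2) (hr : W.analyticRank = 0)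
    (hsurj : Surj W 3) (hSel : Nat.card (W.selmerGroup (3 : ℤ)) = 9)
    (hCT0 : ∃ B : W.sha →+ W.sha →+ AddCircle (1 : ℚ), (∀ x, B x x = 0) ∧
      (∀ x, (∀ y, B x y = 0) ↔ x ∈ AddSubgroup.divisibleElements W.sha) ∧
      ∀ x y : W.sha, 3 • x = 0 → 3 • y = 0 → B x y = 0)
    {q : ℚ} (hq : shaAn W = (q : ℂ)) (hv : padicValRat 3 q = 4) : BSDp W 3 :=
  ClassX4Gord.bsdp_three_rankZero_of_surj_of_casselsTateIsotropic_of_card_selmerThree hDel hGZK hmod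
    hmodD hL20 hKato hX he hr hsurj (d := 2) (by rw [hSel]; norm_num) hCT0 hq (by rw [hv]; norm_num)

end ClassX4M

end Summit.BirchSwinnertonDyer.Rank1Residual.AdditivePotMult

end
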